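import Literature.NumberTheory.EllipticCurves.ModularSymbolsParabolicCohomologyProofs
import Literature.NumberTheory.EllipticCurves.ModularFormsLevelCusps
import HarnessLib

/-!
# The Shapiro count of parabolic cocycles for a general finite-index level `Γ ∋ -1`, part A:
# the permutation representation `ℝ^X`, `X = SL(2, ℤ)/Γ`, its relation operators and cusp sums

Helper file (route `ClassRecordThree`, crux `EulerHalvesAtThree`, residue (ESᶜ-surj-Γ(M)) of the
Cartan-cover line): the tree's `ParabolicCount` (`ModularSymbolsParabolicCohomologyProofs`) proves
`6 dim_ℝ H¹_P(Γ₀(N), ℝ) + 3ε₂ + 4ε₃ + 6ε_∞ ≤ 12 + [SL(2, ℤ) : Γ₀(N)]` by Shapiro's lemma and linear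
algebra in `ℝ^X`, `X = SL(2, ℤ)/Γ₀(N)`. The argument uses the level only through (a) finiteness of
`X`, (b) `-1 ∈ Γ₀(N)` (so that `-1` acts trivially on `X` and `(S^*)² = ((ST)^*)³ = 1`), and (c) the
`⟨T⟩`-orbits on `X` (widths, base points). This file and its sequels (`…LevelCountB`,
`…LevelCountC`) are the **verbatim port to an arbitrary finite-index `Γ ≤ SL(2, ℤ)` with `-1 ∈ Γ`**,
on the `Level` vocabulary of `ModularFormsLevelCusps` (`Level.width`, `Level.orbitFin`, `Level.base`,
`Level.basePoints`), so that the cusp count is `#Level.basePoints Γ` — the same quantity that enters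
the dimension formulas of `ModularFormsGamma1Dimension` for `Γ = ±Γ₁(N)`.

Part A (this file): `coperm` (`g^* f = f ∘ g`), `trace_coperm` (trace = number of fixed cosets),
`relS = 1 + S^*`, `relST = 1 + (ST)^* + (ST)^{*2}` with `2 rk(relS) = μ + ε₂`, `3 rk(relST) = μ + 2ε₃`,
the cusp-sum map `cuspSum : ℝ^X → ℝ^{base points}` (onto, `T^*`-invariant), and the codimension-one
lemma `μ ≤ dim(ker relST + ker cuspSum) + 1`. All proofs are those of `ParabolicCount`; no named
facts; nothing here is specific to BSD.

## References

* G. Shimura, *Introduction to the arithmetic theory of automorphic functions* (1971), §8.1–8.2,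
  Prop. 8.3, (8.2.24) (`n = 0`).
* K. S. Brown, *Cohomology of groups*, GTM 87 (1982), III.6 (Shapiro's lemma).
-/

noncomputable section

open scoped MatrixGroups ModularForm

open CongruenceSubgroup Matrix.SpecialLinearGroup ModularGroup

set_option linter.dupNamespace false

namespace Summit.BirchSwinnertonDyer.BirchSwinnertonDyer.Theorems.EichlerShimuraLevel

open _root_.Module _root_.LinearMap
open Literature.NumberTheory.EllipticCurves.ModularForms
open scoped Classical

variable {Γ : Subgroup SL(2, ℤ)}

/-! ### The permutation representation `ℝ^X`, `X = SL(2, ℤ)/Γ` -/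

variable (Γ) in
/-- The permutation action of `g ∈ SL(2, ℤ)` on `ℝ^X`: `(g^* f)(x) = f(g x)`. [folklore] -/
def coperm (g : SL(2, ℤ)) : ((SL(2, ℤ) ⧸ Γ) → ℝ) →ₗ[ℝ] ((SL(2, ℤ) ⧸ Γ) → ℝ) :=
  LinearMap.funLeft ℝ ℝ (g • ·)

/-- Unfolding `coperm`. [folklore] -/
@[simp] theorem coperm_apply (g : SL(2, ℤ)) (f : (SL(2, ℤ) ⧸ Γ) → ℝ) (x : (SL(2, ℤ) ⧸ Γ)) :
    coperm Γ g f x = f (g • x) := rfl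

/-- `(gh)^* = h^* ∘ g^*`. [folklore] -/
theorem coperm_mul (g h : SL(2, ℤ)) : coperm Γ (g * h) = coperm Γ h ∘ₗ coperm Γ g := by
  apply LinearMap.ext
  intro f
  funext x
  simp [mul_smul]

/-- `1^* = 1`. [folklore] -/
theorem coperm_one : coperm Γ 1 = LinearMap.id := by
  apply LinearMap.ext
  intro f
  funext x
  simp

/-- `(-1) · x = x` on `X` for `-1 ∈ Γ`, in `Fact` form. [folklore] -/
theorem neg_one_smul_coset' [hΓ : Fact ((-1 : SL(2, ℤ)) ∈ Γ)] (q : (SL(2, ℤ) ⧸ Γ)) : (-1 : SL(2, ℤ)) • q = q :=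
  Level.neg_one_smul_coset hΓ.out q

/-- `(-g) · x = g · x` on `X` for `-1 ∈ Γ`. [folklore] -/
theorem neg_smul_coset' [Fact ((-1 : SL(2, ℤ)) ∈ Γ)] (g : SL(2, ℤ)) (q : (SL(2, ℤ) ⧸ Γ)) : (-g) • q = g • q := by
  rw [show -g = g * (-1) by simp, mul_smul, neg_one_smul_coset']

/-- `(-g)^* = g^*` (`-1 ∈ Γ` acts trivially on the cosets). [folklore] -/
theorem coperm_neg [Fact ((-1 : SL(2, ℤ)) ∈ Γ)] (g : SL(2, ℤ)) : coperm Γ (-g) = coperm Γ g := by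
  apply LinearMap.ext
  intro f
  funext x
  simp [neg_smul_coset']

/-- `(-1)^* = 1`. [folklore] -/
theorem coperm_neg_one [Fact ((-1 : SL(2, ℤ)) ∈ Γ)] : coperm Γ (-1) = LinearMap.id := by
  rw [coperm_neg, coperm_one]

/-- `g^* ∘ (g⁻¹)^* = 1`. [folklore] -/
theorem coperm_comp_coperm_inv (g : SL(2, ℤ)) : coperm Γ g ∘ₗ coperm Γ g⁻¹ = LinearMap.id := by
  rw [← coperm_mul, inv_mul_cancel, coperm_one]

/-- `(g⁻¹)^* ∘ g^* = 1`. [folklore] -/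
theorem coperm_inv_comp_coperm (g : SL(2, ℤ)) : coperm Γ g⁻¹ ∘ₗ coperm Γ g = LinearMap.id := by
  rw [← coperm_mul, mul_inv_cancel, coperm_one]

/-- `g^* (g⁻¹)^* f = f`. [folklore] -/
@[simp] theorem coperm_coperm_inv (g : SL(2, ℤ)) (f : (SL(2, ℤ) ⧸ Γ) → ℝ) :
    coperm Γ g (coperm Γ g⁻¹ f) = f := by
  have := congrArg (fun φ ↦ φ f) (coperm_comp_coperm_inv (Γ := Γ) g)
  simpa using this

/-- `(g⁻¹)^* g^* f = f`. [folklore] -/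
@[simp] theorem coperm_inv_coperm (g : SL(2, ℤ)) (f : (SL(2, ℤ) ⧸ Γ) → ℝ) :
    coperm Γ g⁻¹ (coperm Γ g f) = f := by
  have := congrArg (fun φ ↦ φ f) (coperm_inv_comp_coperm (Γ := Γ) g)
  simpa using this

/-- `g^* e_x = e_{g⁻¹x}`. [folklore] -/
theorem coperm_single (g : SL(2, ℤ)) (x : (SL(2, ℤ) ⧸ Γ)) (a : ℝ) :
    coperm Γ g (Pi.single x a) = Pi.single (g⁻¹ • x) a := by
  funext y
  simp only [coperm_apply, Pi.single_apply, eq_inv_smul_iff]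

/-- `S^* ∘ S^* = 1`. [folklore] -/
theorem coperm_S_comp_S [Fact ((-1 : SL(2, ℤ)) ∈ Γ)] : coperm Γ S ∘ₗ coperm Γ S = LinearMap.id := by
  rw [← coperm_mul, S_mul_S_eq_neg_one, coperm_neg_one]

/-- `(ST)²x = x ↔ STx = x` on cosets (`(ST)³` acts trivially). [folklore] -/
theorem ST_smul_iff [Fact ((-1 : SL(2, ℤ)) ∈ Γ)] (q : (SL(2, ℤ) ⧸ Γ)) : (S * T) • (S * T) • q = q ↔ (S * T) • q = q := by
  have h3 : (S * T) • (S * T) • (S * T) • q = q := by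
    rw [← mul_smul, ← mul_smul, ParabolicCount.ST_pow_three_eq, neg_one_smul_coset']
  constructor
  · intro h
    rw [show (S * T) • q = (S * T) • (S * T) • (S * T) • q by rw [h]]
    exact h3
  · intro h
    rw [h, h]

/-- `((ST)^*)³ = 1`. [folklore] -/
theorem coperm_ST_comp_ST_comp_ST [Fact ((-1 : SL(2, ℤ)) ∈ Γ)] :
    coperm Γ (S * T) ∘ₗ (coperm Γ (S * T) ∘ₗ coperm Γ (S * T)) = LinearMap.id := by
  rw [← coperm_mul, ← coperm_mul, ParabolicCount.ST_pow_three_eq, coperm_neg_one]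

variable (Γ) in
/-- The operator `1 + S^*` on `ℝ^X` (twice the projection onto the `S^*`-invariants). [folklore] -/
def relS : ((SL(2, ℤ) ⧸ Γ) → ℝ) →ₗ[ℝ] ((SL(2, ℤ) ⧸ Γ) → ℝ) := LinearMap.id + coperm Γ S

variable (Γ) in
/-- The operator `1 + (ST)^* + (ST)^{*2}` on `ℝ^X` (three times the projection onto the
`(ST)^*`-invariants). [folklore] -/
def relST : ((SL(2, ℤ) ⧸ Γ) → ℝ) →ₗ[ℝ] ((SL(2, ℤ) ⧸ Γ) → ℝ) :=
  LinearMap.id + coperm Γ (S * T) + coperm Γ (S * T) ∘ₗ coperm Γ (S * T)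

/-- `(1 + S^*)² = 2(1 + S^*)`. [folklore] -/
theorem relS_comp_relS [Fact ((-1 : SL(2, ℤ)) ∈ Γ)] : relS Γ ∘ₗ relS Γ = (2 : ℝ) • relS Γ := by
  rw [show (2 : ℝ) = ((2 : ℕ) : ℝ) by norm_num, Nat.cast_smul_eq_nsmul]
  simp only [relS, LinearMap.add_comp, LinearMap.comp_add, LinearMap.id_comp, LinearMap.comp_id,
    coperm_S_comp_S]
  abel

/-- `(1 + (ST)^* + (ST)^{*2})² = 3(1 + (ST)^* + (ST)^{*2})`. [folklore] -/
theorem relST_comp_relST [Fact ((-1 : SL(2, ℤ)) ∈ Γ)] : relST Γ ∘ₗ relST Γ = (3 : ℝ) • relST Γ := by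
  rw [show (3 : ℝ) = ((3 : ℕ) : ℝ) by norm_num, Nat.cast_smul_eq_nsmul]
  have h3 := coperm_ST_comp_ST_comp_ST (Γ := Γ)
  simp only [relST, LinearMap.add_comp, LinearMap.comp_add, LinearMap.id_comp, LinearMap.comp_id,
    LinearMap.comp_assoc, h3]
  abel

/-! ### The cusp sums and the counts on the finite coset space -/

section Finite

variable [Γ.FiniteIndex]

/-! ### The cusp sums: `b ↦ (∑_{x ∈ orbit} b(x))_{orbits of T}` -/

variable (Γ) in
/-- The **cusp-sum map** `ℝ^X → ℝ^{cusps}`: `b ↦ (∑_{y ∈ ⟨T⟩x} b(y))_x`, indexed by the base points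
`x` of the `⟨T⟩`-orbits on `X = SL(2, ℤ)/Γ` (`Level.basePoints`, one per orbit,
`Level.basePointsEquiv`). [folklore] -/
def cuspSum : ((SL(2, ℤ) ⧸ Γ) → ℝ) →ₗ[ℝ] ({x // x ∈ Level.basePoints Γ} → ℝ) where
  toFun b p := ∑ y ∈ Level.orbitFin Γ p.1, b y
  map_add' b b' := by
    funext p
    simp [Finset.sum_add_distrib]
  map_smul' c b := by
    funext p
    simp [Finset.mul_sum]

/-- Unfolding `cuspSum`. [folklore] -/
@[simp] theorem cuspSum_apply (b : (SL(2, ℤ) ⧸ Γ) → ℝ) (p : {x // x ∈ Level.basePoints Γ}) :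
    cuspSum Γ b p = ∑ y ∈ Level.orbitFin Γ p.1, b y := rfl

/-- The cusp sums are `T^*`-invariant. [folklore] -/
theorem cuspSum_coperm_T (b : (SL(2, ℤ) ⧸ Γ) → ℝ) : cuspSum Γ (coperm Γ T b) = cuspSum Γ b := by
  funext p
  obtain ⟨p, hp⟩ := p
  simp only [cuspSum_apply, coperm_apply]
  rw [Level.sum_orbitFin_eq, Level.sum_orbitFin_eq]
  simp_rw [smul_smul, ← pow_succ']
  have h := Finset.sum_range_succ' (fun i ↦ b (T ^ i • p)) (Level.width Γ p)
  have h' := Finset.sum_range_succ (fun i ↦ b (T ^ i • p)) (Level.width Γ p)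
  rw [Level.T_pow_width_smul] at h'
  simp only [pow_zero, one_smul] at h
  linarith

/-- The cusp-sum map is onto `ℝ^{cusps}`. [folklore] -/
theorem cuspSum_surjective : Function.Surjective (cuspSum Γ) := by
  intro h
  refine ⟨fun x ↦ if hx : x ∈ Level.basePoints Γ then h ⟨x, hx⟩ else 0, ?_⟩
  funext p
  obtain ⟨p, hp⟩ := p
  rw [cuspSum_apply, Finset.sum_eq_single p]
  · simp [hp]
  · intro y hy hyp
    rw [dif_neg]
    intro hyb
    have h1 : Level.base Γ y = Level.base Γ p := Level.base_eq_of_mem Γ hy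
    rw [(Finset.mem_filter.mp hyb).2, (Finset.mem_filter.mp hp).2] at h1
    exact hyp h1
  · intro hnp
    exact absurd (Level.self_mem_orbitFin Γ p) hnp

/-- `rank(cusp sums) = #(base points)`. [folklore] -/
theorem finrank_range_cuspSum : finrank ℝ (range (cuspSum Γ)) = (Level.basePoints Γ).card := by
  rw [LinearMap.range_eq_top.mpr cuspSum_surjective, finrank_top, finrank_fintype_fun_eq_card,
    Fintype.card_coe]

/-! ### Finiteness of `X`: the trace counts and the codimension-one lemma

The `Fintype` structure on `SL(2, ℤ)/Γ` is taken as an instance argument (consumers supply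
`Fintype.ofFinite _`, as the `Level` files do locally). -/

variable [Fintype (SL(2, ℤ) ⧸ Γ)]

/-- **The trace of a permutation matrix is its number of fixed points.** [folklore] -/
theorem trace_coperm (g : SL(2, ℤ)) :
    LinearMap.trace ℝ _ (coperm Γ g) =
      ((Finset.univ.filter fun x : (SL(2, ℤ) ⧸ Γ) ↦ g • x = x).card : ℝ) := by
  rw [LinearMap.trace_eq_matrix_trace ℝ (Pi.basisFun ℝ (SL(2, ℤ) ⧸ Γ)), Matrix.trace]
  simp only [Matrix.diag, LinearMap.toMatrix_apply, Pi.basisFun_repr, coperm_apply,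
    Pi.basisFun_apply, Pi.single_apply]
  rw [Finset.card_filter]
  push_cast
  rfl

/-- `2 dim range(1 + S^*) = μ + ε₂` with `ε₂ = #{x : Sx = x}`. [folklore] -/
theorem two_mul_finrank_range_relS [Fact ((-1 : SL(2, ℤ)) ∈ Γ)] :
    2 * finrank ℝ (range (relS Γ)) =
      Fintype.card (SL(2, ℤ) ⧸ Γ) + (Finset.univ.filter fun q : (SL(2, ℤ) ⧸ Γ) ↦ S • q = q).card := by
  have h := ParabolicCount.trace_eq_mul_finrank_range (relS Γ) two_ne_zero relS_comp_relS
  have htr : LinearMap.trace ℝ _ (relS Γ) =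
      (Fintype.card (SL(2, ℤ) ⧸ Γ) : ℝ) + (Finset.univ.filter fun q : (SL(2, ℤ) ⧸ Γ) ↦ S • q = q).card := by
    rw [relS, map_add, LinearMap.trace_id, finrank_fintype_fun_eq_card, trace_coperm]
  rw [htr] at h
  exact_mod_cast h.symm

/-- `3 dim range(1 + (ST)^* + (ST)^{*2}) = μ + 2ε₃` with `ε₃ = #{x : STx = x}`. [folklore] -/
theorem three_mul_finrank_range_relST [Fact ((-1 : SL(2, ℤ)) ∈ Γ)] :
    3 * finrank ℝ (range (relST Γ)) =
      Fintype.card (SL(2, ℤ) ⧸ Γ) + 2 * (Finset.univ.filter fun q : (SL(2, ℤ) ⧸ Γ) ↦ (S * T) • q = q).card := by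
  have h := ParabolicCount.trace_eq_mul_finrank_range (relST Γ) three_ne_zero relST_comp_relST
  have h2 : coperm Γ (S * T) ∘ₗ coperm Γ (S * T) = coperm Γ ((S * T) * (S * T)) :=
    (coperm_mul _ _).symm
  have hfix : (Finset.univ.filter fun q : (SL(2, ℤ) ⧸ Γ) ↦ ((S * T) * (S * T)) • q = q) =
      Finset.univ.filter fun q : (SL(2, ℤ) ⧸ Γ) ↦ (S * T) • q = q :=
    Finset.filter_congr fun q _ ↦ by rw [mul_smul]; exact ST_smul_iff q
  have htr : LinearMap.trace ℝ _ (relST Γ) = (Fintype.card (SL(2, ℤ) ⧸ Γ) : ℝ) +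
      2 * (Finset.univ.filter fun q : (SL(2, ℤ) ⧸ Γ) ↦ (S * T) • q = q).card := by
    rw [relST, map_add, map_add, LinearMap.trace_id, finrank_fintype_fun_eq_card, h2, trace_coperm,
      trace_coperm, hfix]
    ring
  rw [htr] at h
  exact_mod_cast h.symm

/-- **`ker(1 + (ST)^* + (ST)^{*2}) + ker(cusp sums)` has codimension `≤ 1`**: it contains
`Pf - f` for `P = (ST)^*` (as `(1 + P + P²)(P - 1) = P³ - 1 = 0`) and for `P = T^*`, hence for
`P = g^*`, all `g ∈ ⟨ST, T⟩ = SL(2, ℤ)`, hence every `e_y - e_x` (`SL(2, ℤ)` is transitive on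
`X`). [folklore] -/
theorem card_le_finrank_ker_sup_add_one [Fact ((-1 : SL(2, ℤ)) ∈ Γ)] :
    Fintype.card (SL(2, ℤ) ⧸ Γ) ≤
      finrank ℝ ↥(LinearMap.ker (relST Γ) ⊔ LinearMap.ker (cuspSum Γ)) + 1 := by
  set R : Submodule ℝ ((SL(2, ℤ) ⧸ Γ) → ℝ) := LinearMap.ker (relST Γ) ⊔ LinearMap.ker (cuspSum Γ)
    with hR
  have hST : ∀ f : (SL(2, ℤ) ⧸ Γ) → ℝ, coperm Γ (S * T) f - f ∈ R := fun f ↦ by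
    refine Submodule.mem_sup_left ?_
    rw [LinearMap.mem_ker]
    have h3 := congrArg (fun φ ↦ φ f) (coperm_ST_comp_ST_comp_ST (Γ := Γ))
    simp only [LinearMap.comp_apply, LinearMap.id_apply] at h3
    simp only [relST, map_sub, LinearMap.add_apply, LinearMap.id_apply, LinearMap.comp_apply, h3]
    abel
  have hT : ∀ f : (SL(2, ℤ) ⧸ Γ) → ℝ, coperm Γ T f - f ∈ R := fun f ↦ by
    refine Submodule.mem_sup_right ?_
    rw [LinearMap.mem_ker, map_sub, cuspSum_coperm_T, sub_self]
  -- the subgroup of `g` with `g^* f - f ∈ R` for all `f`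
  let K : Subgroup SL(2, ℤ) :=
    { carrier := {g | ∀ f : (SL(2, ℤ) ⧸ Γ) → ℝ, coperm Γ g f - f ∈ R}
      mul_mem' := fun {a b} ha hb f ↦ by
        rw [coperm_mul, LinearMap.comp_apply, ← sub_add_sub_cancel _ (coperm Γ a f) f]
        exact R.add_mem (hb _) (ha f)
      one_mem' := fun f ↦ by simp [coperm_one]
      inv_mem' := fun {a} ha f ↦ by
        have h := R.neg_mem (ha (coperm Γ a⁻¹ f))
        rwa [coperm_coperm_inv, neg_sub] at h }
  have hTK : T ∈ K := hT
  have hSK : S ∈ K := by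
    have : S = S * T * T⁻¹ := by group
    rw [this]
    exact K.mul_mem hST (K.inv_mem hTK)
  have hK : K = ⊤ := by
    rw [eq_top_iff, ← SpecialLinearGroup.SL2Z_generators, Subgroup.closure_le]
    intro g hg
    rcases hg with rfl | rfl
    · exact hSK
    · exact hTK
  have hsingle : ∀ x y : (SL(2, ℤ) ⧸ Γ), Pi.single y (1 : ℝ) - Pi.single x 1 ∈ R := by
    intro x y
    obtain ⟨g, hg⟩ : ∃ g : SL(2, ℤ), g⁻¹ • x = y := by
      induction x using QuotientGroup.induction_on with
      | H a =>
        induction y using QuotientGroup.induction_on with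
        | H b =>
          refine ⟨a * b⁻¹, ?_⟩
          rw [MulAction.Quotient.smul_mk, smul_eq_mul, mul_inv_rev, inv_inv, mul_assoc,
            inv_mul_cancel, mul_one]
    have h := (hK ▸ Subgroup.mem_top g : g ∈ K) (Pi.single x 1)
    rwa [coperm_single, hg] at h
  set x₀ : (SL(2, ℤ) ⧸ Γ) := ((1 : SL(2, ℤ)) : (SL(2, ℤ) ⧸ Γ))
  set L : Submodule ℝ ((SL(2, ℤ) ⧸ Γ) → ℝ) := Submodule.span ℝ {Pi.single x₀ 1}
  have htop : (⊤ : Submodule ℝ ((SL(2, ℤ) ⧸ Γ) → ℝ)) ≤ R ⊔ L := by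
    rw [← (Pi.basisFun ℝ _).span_eq, Submodule.span_le]
    rintro _ ⟨x, rfl⟩
    rw [Pi.basisFun_apply]
    have : (Pi.single x (1 : ℝ) : (SL(2, ℤ) ⧸ Γ) → ℝ) =
        (Pi.single x 1 - Pi.single x₀ 1) + Pi.single x₀ 1 := by abel
    rw [this]
    exact Submodule.add_mem_sup (hsingle x₀ x) (Submodule.subset_span rfl)
  have h1 : finrank ℝ L ≤ 1 := by
    simpa using finrank_span_le_card ({Pi.single x₀ (1 : ℝ)} : Set ((SL(2, ℤ) ⧸ Γ) → ℝ))
  have h2 := Submodule.finrank_mono htop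
  rw [finrank_top, finrank_fintype_fun_eq_card] at h2
  have h3 := Submodule.finrank_add_le_finrank_add_finrank R L
  omega

end Finite

end Summit.BirchSwinnertonDyer.BirchSwinnertonDyer.Theorems.EichlerShimuraLevel

end
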